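import Literature.AlgebraicGeometry.Hyperkaehler.GeneralizedKummerType
import Literature.AlgebraicGeometry.Hyperkaehler.LLVGeneration
import Literature.AlgebraicGeometry.HodgeTheory.ComplexOrientationFamily
import HarnessLib

/-!
# The restriction `θ* : H*(A^[n]) → H*(K_{n−1}(A))` to a generalized Kummer variety: kernel = annihilator of
`[K_{n−1}(A)]` = the ideal generated by `H¹(A^[n])` (Kapfer–Menet 2018, §5) — named facts

Layer `Literature/AlgebraicGeometry/Hyperkaehler`; rider on `GeneralizedKummerType` (the tree's points-free
`IsGeneralizedKummerVarietyOf m A K`: `K` is the fibre `j : K ⟶ H` over the unit section of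
`s₀ = alb − alb(x₀) : H = A^[m+1] ⟶ Alb(A^[m+1])`, i.e. a fibre of Beauville's sum morphism `Σ : A^[n] → A`,
`n = m + 1`, isomorphic to `K_{n−1}(A) = Σ⁻¹(0)` by a translation).  S. Kapfer, G. Menet, *Integral cohomology of the
generalized Kummer fourfold*, Algebraic Geometry 5 (2018) (arXiv:1607.03431), §5 "Cohomology of generalized Kummer
varieties via Hilbert scheme cohomology", for `A` an abelian surface ("complex projective torus of dimension 2"),
`θ : K_{n−1}(A) ↪ A^[n]` the inclusion of the fibre of `Σ` over `0`:

* (5.3) "`θ_*θ*(α) = [K_{n−1}(A)] · α`" (projection formula);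
* **Lemma 5.4**: "Let `β ∈ H*(K_{n−1}(A), ℚ)`. Then there is a class `B ∈ H*(A^[n], ℚ)` such that
  `θ_*(β) = n⁻⁴ B · [K_{n−1}(A)]`" — proof: "`Θ : K_{n−1}(A) × A → A^[n]`, `Θ(ξ, a) = t_a(θ(ξ))` … fits in a
  pullback diagram [over `n· : A → A`] that realizes `K_{n−1}(A) × A` as a `n⁴`-fold covering of `A^[n]`";
* **Proposition 5.5**: "The kernel of `θ*` is equal to the annihilator of `[K_{n−1}(A)]`";
* **Proposition 5.7**: "The annihilator of `[K_{n−1}(A)]` in `H*(A^[n], ℚ)` is the ideal generated by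
  `H¹(A^[n])`".

## Rendering (tree carriers) and design

* The pair `(H, j)` is quantified with the defining clauses of `IsGeneralizedKummerVarietyOf m A K` UNPACKED (the
  statements need the specific `j : K ⟶ H`), plus the smoothness of `K` (`Motives.IsSmoothProjective (2m) K`, the
  companion hypothesis of every printed statement about `Kumᵐ`).  Every fibre of `Σ` is a translate of `Σ⁻¹(0)` and
  translations by points of the connected group `A` act trivially on `H*(A^[n])`, so the printed statements hold for
  the tree's fibre verbatim.
* `θ* = totalPullback ℂ j(ℂ)` on the total cohomology `H*(A^[n](ℂ); ℂ)` (file `LLVGeneration`); the class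
  `[K] = θ_*(1) ∈ H⁴(A^[n](ℂ); ℂ)` is `kummerFibreClass`, the tree's real Gysin morphism `HodgeTheory.complexGysin` for the
  complex orientation family applied to `1 ∈ H⁰(K(ℂ))` (`dim K = 2m`, `dim H = 2m + 2`, degree `0 + 2(2m+2) = 4 + 2·2m`);
  `θ_*` on total cohomology is `totalGysin` (the degreewise `complexGysin`, degree shift `4`).
* The ANNIHILATOR of a class `c` is the kernel of left cup-multiplication `totalCup c`; the IDEAL generated by
  `H¹` is `cupIdeal` = the span of the products `x ∪ g`, `g ∈ H¹` (a left ideal; two-sided by graded commutativity).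
* Coefficients `ℂ` (the printed statements are over `ℚ`; base change).

NAMED FACTS (no proofs here): `KapferMenet2018_lemma_5_4`, `KapferMenet2018_ker_pullback_eq_annihilator` (Prop. 5.5),
`KapferMenet2018_annihilator_eq_idealH1` (Prop. 5.7).  PROVED: unfolding lemmas only.

## Not here (reported to the consumers)

The morphism `Θ(ξ, a) = t_a(θ(ξ))` and its cartesian square over `n· : A → A` (Beauville 1983 §7 footnote 2;
Kapfer–Menet (5.4)) — it needs the translation action of `A` on `A^[n]` (by functoriality of the Hilbert scheme)
and Beauville's equivariance `Σ(t_a ξ) = Σ(ξ) + n a`, neither of which the points-free `IsGeneralizedKummerVarietyOf`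
exposes; the consequence used downstream, `Θ* : H*(A^[n]) ≅ (H*(K) ⊗ H*(A))^{A[n]}` and `im θ* = H*(K)^{A[n]}`, is a
theorem about that square plus transfer for finite quotients.  Prop. 5.3 (`[K_{n−1}(A)] = α₁α₂α₃α₄`,
`αᵢ = G₀(aᵢ)1`) lives with the Nakajima-operator interface (`HilbertScheme/ChernCharacterOperators`) and is not
recorded.  Theorem 5.2 (torsion-freeness), §6–7 (integral bases, the Kummer fourfold).
-/

noncomputable section

open CategoryTheory MonoidalCategory CartesianMonoidalCategory DirectSum
open Literature.AlgebraicTopology.SingularHomology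
open Literature.AlgebraicGeometry.HilbertScheme (IsHilbertSchemeOfPoints)
open Literature.AlgebraicGeometry.HodgeTheory (complexBetti complexGysin complexOrientationFamily)

namespace Literature.AlgebraicGeometry.Hyperkaehler

open scoped MonObj

/-! ### Total Gysin morphisms, annihilators, ideals -/

section Tools

variable {m n : ℕ} {Y X : Motives.SchemeOver ℂ}

/-- **The Gysin morphism on total cohomology** `f_* : H*(Y(ℂ); ℂ) → H*(X(ℂ); ℂ)` of a morphism `f : Y ⟶ X` of smooth
projective varieties (`dim Y = m`, `dim X = n`), degree shift `c = 2(n − m)` (`c + 2m = 2n`): the tree's degreewise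
`HodgeTheory.complexGysin` for the complex orientation family, assembled on `⨁ₖ Hᵏ`.
[cite: KapferMenet2018, §5 (5.3) p. 13] [cite: FultonYoungTableaux1997, Appendix B §B.1 (5)] -/
def totalGysin (hY : Motives.IsSmoothProjective m Y) (hX : Motives.IsSmoothProjective n X) (f : Y ⟶ X) (c : ℕ)
    (hc : c + 2 * m = 2 * n) :
    totalCohomology ℂ (Motives.ComplexPoints Y) →ₗ[ℂ] totalCohomology ℂ (Motives.ComplexPoints X) :=
  toModule ℂ ℕ _ fun a ↦
    ofDegree ℂ (Motives.ComplexPoints X) (a + c) ∘ₗ complexGysin complexOrientationFamily hY hX f (by omega)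

/-- On a homogeneous class the total Gysin morphism is `complexGysin` placed in degree `a + c`.
[cite: FultonYoungTableaux1997, Appendix B §B.1 (5)] -/
@[simp]
theorem totalGysin_ofDegree (hY : Motives.IsSmoothProjective m Y) (hX : Motives.IsSmoothProjective n X) (f : Y ⟶ X)
    (c : ℕ) (hc : c + 2 * m = 2 * n) (a : ℕ) (y : complexBetti Y a) :
    totalGysin hY hX f c hc (ofDegree ℂ (Motives.ComplexPoints Y) a y) =
      ofDegree ℂ (Motives.ComplexPoints X) (a + c) (complexGysin complexOrientationFamily hY hX f (by omega) y) := by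
  simp [totalGysin, toModule_lof]

universe u v

variable (R : Type v) [CommRing R] (Z : Type u) [TopologicalSpace Z]

/-- **The annihilator of a class `c ∈ H*(Z; R)`**: `{α | c ∪ α = 0}`, the kernel of left cup-multiplication by `c`
(the tree's `totalCup`). [cite: KapferMenet2018, Prop. 5.5 p. 13] -/
def cupAnnihilator (c : totalCohomology R Z) : Submodule R (totalCohomology R Z) :=
  LinearMap.ker (totalCup R Z c)

/-- **The (left) ideal of `H*(Z; R)` generated by a set `G`**: the `R`-span of the products `x ∪ g`, `x ∈ H*(Z; R)`,
`g ∈ G` (for `G = H¹`: "the ideal generated by `H¹`"; left = two-sided by graded commutativity of `∪`).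
[cite: KapferMenet2018, Prop. 5.7 p. 13] -/
def cupIdeal (G : Set (totalCohomology R Z)) : Submodule R (totalCohomology R Z) :=
  Submodule.span R {z | ∃ (x : totalCohomology R Z) (g : totalCohomology R Z), g ∈ G ∧ z = totalCup R Z x g}

variable {R Z}

/-- Unfolding: `α` annihilates `c` iff `c ∪ α = 0`. [cite: KapferMenet2018, Prop. 5.5 p. 13] -/
theorem mem_cupAnnihilator_iff (c α : totalCohomology R Z) : α ∈ cupAnnihilator R Z c ↔ totalCup R Z c α = 0 :=
  LinearMap.mem_ker

/-- A product `x ∪ g` with `g ∈ G` lies in the ideal generated by `G`. [cite: KapferMenet2018, Prop. 5.7 p. 13] -/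
theorem totalCup_mem_cupIdeal {G : Set (totalCohomology R Z)} (x : totalCohomology R Z) {g : totalCohomology R Z}
    (hg : g ∈ G) : totalCup R Z x g ∈ cupIdeal R Z G :=
  Submodule.subset_span ⟨x, g, hg, rfl⟩

end Tools

/-! ### The class of the Kummer fibre and the three statements of Kapfer–Menet §5 -/

section KapferMenet

variable {m : ℕ} {A : Motives.AbelianVariety ℂ} {K H : Motives.SchemeOver ℂ}

/-- **The class `[K_{n−1}(A)] = θ_*(1) ∈ H⁴(A^[n](ℂ); ℂ)`** of a generalized Kummer fibre `j : K ⟶ H = A^[m+1]`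
(`dim K = 2m`, `dim H = 2m + 2`; Gysin image of `1 ∈ H⁰(K(ℂ))`).
[cite: KapferMenet2018, §5 Prop. 5.3 and (5.3) (p. 13)] -/
def kummerFibreClass (hKs : Motives.IsSmoothProjective (2 * m) K) (hH : Motives.IsSmoothProjective (2 * (m + 1)) H)
    (j : K ⟶ H) : complexBetti H 4 :=
  complexGysin complexOrientationFamily hKs hH j (a := 0) (b := 4) (by ring)
    (singularCohomology.one ℂ (Motives.ComplexPoints K))

/-- The class `[K]` placed in the total cohomology `H*(A^[n](ℂ); ℂ)`. [cite: KapferMenet2018, (5.3) p. 13] -/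
def kummerFibreClassTotal (hKs : Motives.IsSmoothProjective (2 * m) K)
    (hH : Motives.IsSmoothProjective (2 * (m + 1)) H) (j : K ⟶ H) : totalCohomology ℂ (Motives.ComplexPoints H) :=
  ofDegree ℂ (Motives.ComplexPoints H) 4 (kummerFibreClass hKs hH j)

/-- `[K]` is `θ_*(1)` on total cohomology (degree shift `4`). [cite: KapferMenet2018, (5.3) p. 13] -/
theorem totalGysin_one (hKs : Motives.IsSmoothProjective (2 * m) K) (hH : Motives.IsSmoothProjective (2 * (m + 1)) H)
    (j : K ⟶ H) :
    totalGysin hKs hH j 4 (by ring) (ofDegree ℂ (Motives.ComplexPoints K) 0 (singularCohomology.one ℂ _)) =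
      kummerFibreClassTotal hKs hH j := by
  rw [totalGysin_ofDegree, kummerFibreClassTotal, kummerFibreClass]

end KapferMenet

/-- **Kapfer–Menet, Lemma 5.4.**  For an abelian surface `A`, `n = m + 1 ≥ 1`, and a generalized Kummer fibre
`θ = j : K ⟶ H = A^[n]` (the clauses of `IsGeneralizedKummerVarietyOf m A K`, `K` smooth projective of dimension
`2m`): for every `β ∈ H*(K(ℂ); ℂ)` there is `B ∈ H*(A^[n](ℂ); ℂ)` with `θ_*(β) = n⁻⁴ · (B ∪ [K])` ("Then there is a class
`B ∈ H*(A^[n], ℚ)` such that `θ_*(β) = (1/n⁴) B · [K_{n−1}(A)]`"; from the `n⁴`-fold covering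
`Θ : K × A → A^[n]`, `Θ(ξ, a) = t_a(θ(ξ))`). [cite: KapferMenet2018, Lemma 5.4 (p. 13)] -/
def KapferMenet2018_lemma_5_4 : Prop :=
  ∀ ⦃m : ℕ⦄ ⦃A : Motives.AbelianVariety ℂ⦄ ⦃K H : Motives.SchemeOver ℂ⦄, A.dim = 2 →
    ∀ (Ξ : (A.X ⊗ H).left.IdealSheafData) (𝒜 : Motives.Jacobian H) (x₀ : 𝟙_ (Motives.SchemeOver ℂ) ⟶ H)
      (j : K ⟶ H), IsHilbertSchemeOfPoints (m + 1) A.X H Ξ →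
      ∀ (hH : Motives.IsSmoothProjective (2 * (m + 1)) H),
      IsPullback j (toUnit K) (lift (𝟙 H) (toUnit H ≫ x₀) ≫ 𝒜.diff) (1 : 𝟙_ (Motives.SchemeOver ℂ) ⟶ 𝒜.J.X) →
      ∀ (hKs : Motives.IsSmoothProjective (2 * m) K) (β : totalCohomology ℂ (Motives.ComplexPoints K)),
        ∃ B : totalCohomology ℂ (Motives.ComplexPoints H),
          totalGysin hKs hH j 4 (by ring) β =
            (((m + 1 : ℕ) : ℂ) ^ 4)⁻¹ • totalCup ℂ (Motives.ComplexPoints H) B (kummerFibreClassTotal hKs hH j)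

/-- **Kapfer–Menet, Proposition 5.5: `ker θ* = Ann([K_{n−1}(A)])`.**  Same setting: the kernel of
`θ* = j(ℂ)* : H*(A^[n](ℂ); ℂ) → H*(K(ℂ); ℂ)` (on total cohomology) is the annihilator of the class `[K] ∈ H⁴(A^[n])`.
[cite: KapferMenet2018, Prop. 5.5 (p. 13)] -/
def KapferMenet2018_ker_pullback_eq_annihilator : Prop :=
  ∀ ⦃m : ℕ⦄ ⦃A : Motives.AbelianVariety ℂ⦄ ⦃K H : Motives.SchemeOver ℂ⦄, A.dim = 2 →
    ∀ (Ξ : (A.X ⊗ H).left.IdealSheafData) (𝒜 : Motives.Jacobian H) (x₀ : 𝟙_ (Motives.SchemeOver ℂ) ⟶ H)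
      (j : K ⟶ H), IsHilbertSchemeOfPoints (m + 1) A.X H Ξ →
      ∀ (hH : Motives.IsSmoothProjective (2 * (m + 1)) H),
      IsPullback j (toUnit K) (lift (𝟙 H) (toUnit H ≫ x₀) ≫ 𝒜.diff) (1 : 𝟙_ (Motives.SchemeOver ℂ) ⟶ 𝒜.J.X) →
      ∀ (hKs : Motives.IsSmoothProjective (2 * m) K),
        LinearMap.ker (totalPullback ℂ (Motives.AlgPoints.mapContinuous (L := ℂ) j)) =
          cupAnnihilator ℂ (Motives.ComplexPoints H) (kummerFibreClassTotal hKs hH j)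

/-- **Kapfer–Menet, Proposition 5.7: `Ann([K_{n−1}(A)])` is the ideal generated by `H¹(A^[n])`.**  Same setting:
the annihilator of `[K] ∈ H⁴(A^[n](ℂ); ℂ)` in `H*(A^[n](ℂ); ℂ)` is the ideal generated by the degree-`1` classes.
[cite: KapferMenet2018, Prop. 5.7 (pp. 13–14)] -/
def KapferMenet2018_annihilator_eq_idealH1 : Prop :=
  ∀ ⦃m : ℕ⦄ ⦃A : Motives.AbelianVariety ℂ⦄ ⦃K H : Motives.SchemeOver ℂ⦄, A.dim = 2 →
    ∀ (Ξ : (A.X ⊗ H).left.IdealSheafData) (𝒜 : Motives.Jacobian H) (x₀ : 𝟙_ (Motives.SchemeOver ℂ) ⟶ H)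
      (j : K ⟶ H), IsHilbertSchemeOfPoints (m + 1) A.X H Ξ →
      ∀ (hH : Motives.IsSmoothProjective (2 * (m + 1)) H),
      IsPullback j (toUnit K) (lift (𝟙 H) (toUnit H ≫ x₀) ≫ 𝒜.diff) (1 : 𝟙_ (Motives.SchemeOver ℂ) ⟶ 𝒜.J.X) →
      ∀ (hKs : Motives.IsSmoothProjective (2 * m) K),
        cupAnnihilator ℂ (Motives.ComplexPoints H) (kummerFibreClassTotal hKs hH j) =
          cupIdeal ℂ (Motives.ComplexPoints H) (degreeClasses ℂ (Motives.ComplexPoints H) {1})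

/-- Props. 5.5 and 5.7 together: **`ker θ*` is the ideal generated by `H¹(A^[n])`** (the form quoted in the
introduction: "the kernel of `θ*` is the ideal generated by `H¹(A^[3], ℤ)`", there for `n = 3` and integrally).
[cite: KapferMenet2018, §1 (overview of §5) and Props. 5.5, 5.7] -/
theorem ker_pullback_eq_idealH1 (h₅ : KapferMenet2018_ker_pullback_eq_annihilator)
    (h₇ : KapferMenet2018_annihilator_eq_idealH1) ⦃m : ℕ⦄ ⦃A : Motives.AbelianVariety ℂ⦄
    ⦃K H : Motives.SchemeOver ℂ⦄ (hA : A.dim = 2) (Ξ : (A.X ⊗ H).left.IdealSheafData) (𝒜 : Motives.Jacobian H)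
    (x₀ : 𝟙_ (Motives.SchemeOver ℂ) ⟶ H) (j : K ⟶ H) (hHilb : IsHilbertSchemeOfPoints (m + 1) A.X H Ξ)
    (hH : Motives.IsSmoothProjective (2 * (m + 1)) H)
    (hsq : IsPullback j (toUnit K) (lift (𝟙 H) (toUnit H ≫ x₀) ≫ 𝒜.diff) (1 : 𝟙_ (Motives.SchemeOver ℂ) ⟶ 𝒜.J.X))
    (hKs : Motives.IsSmoothProjective (2 * m) K) :
    LinearMap.ker (totalPullback ℂ (Motives.AlgPoints.mapContinuous (L := ℂ) j)) =
      cupIdeal ℂ (Motives.ComplexPoints H) (degreeClasses ℂ (Motives.ComplexPoints H) {1}) := by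
  rw [h₅ hA Ξ 𝒜 x₀ j hHilb hH hsq hKs, h₇ hA Ξ 𝒜 x₀ j hHilb hH hsq hKs]

/-- The Kummer fibre of the data IS a generalized Kummer variety of `A` in the tree's sense (the hypotheses of the
three facts are exactly the clauses of `IsGeneralizedKummerVarietyOf`). [cite: Beauville1983, §7 p. 769] -/
theorem isGeneralizedKummerVarietyOf_of_data {m : ℕ} {A : Motives.AbelianVariety ℂ} {K H : Motives.SchemeOver ℂ}
    (Ξ : (A.X ⊗ H).left.IdealSheafData) (𝒜 : Motives.Jacobian H) (x₀ : 𝟙_ (Motives.SchemeOver ℂ) ⟶ H) (j : K ⟶ H)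
    (hHilb : IsHilbertSchemeOfPoints (m + 1) A.X H Ξ) (hH : Motives.IsSmoothProjective (2 * (m + 1)) H)
    (hsq : IsPullback j (toUnit K) (lift (𝟙 H) (toUnit H ≫ x₀) ≫ 𝒜.diff) (1 : 𝟙_ (Motives.SchemeOver ℂ) ⟶ 𝒜.J.X)) :
    IsGeneralizedKummerVarietyOf m A K :=
  ⟨H, Ξ, 𝒜, x₀, j, hHilb, hH, hsq⟩

end Literature.AlgebraicGeometry.Hyperkaehler

end
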